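import Summits.ValiantsHypothesis.ValiantsHypothesis.Theorems.LacunarySymmetroidMatrixDescartesPivotRankOneCriticalWindowsRootCount
import Summits.ValiantsHypothesis.ValiantsHypothesis.Theorems.LacunarySymmetroidMatrixDescartesPivotRankOneCriticalWindowsLoneAllRates
import Summits.ValiantsHypothesis.ValiantsHypothesis.Theorems.LacunarySymmetroidMatrixDescartesCensusPivotDefs

/-!
# `MatrixDescartes` census — rank-one `(2,K)₁`: THE LONE SIDE CONTRIBUTES AT MOST TWO TO `Z₊`, and the pipeline in census currency

HONEST FRAMING.  Object-search cell `pub-symmetroid`, seat `val-sym-mdr-p1` (generation 25); helper file `--supports` the crux item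
stmt-ValiantsHypothesis-18050 (`Theses.LacunarySymmetroid.MatrixDescartes`, OPEN, on HOLD) with NO closure claim.  Companion of
`…CriticalWindowsRootCount` (the pipeline `Z₊(det F) ≤ 1 + C_L + C_R` from side budgets for the critical directions of the window profile to
the number of distinct positive zeros of `det F`, `F(x) = x^e[[0,1],[1,0]] + ∑ₖ wₖx^{dₖ}(1,tₖ)(1,tₖ)ᵀ`).  THIS FILE plugs in the lineage's
LONE-LETTER LAW (`…CriticalWindowsLoneAllRates`, p698043: one letter beyond the pivot letter's position, all others below it, any positive
rates ⇒ no three critical directions on the lone side) and restates the pipeline in the census currency `pivotPosRoots` of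
`…CensusPivotDefs`.  A COUNTING INSTRUMENT for one sub-row (`m = 2`, one letter `p` with `dₚ < e`, the others with `dₘ > e`); nothing here
bears on `MatrixDescartes` in its window, on `DoorA26` / `DoorA34`, registers / credences, or `VP ≠ VNP`; the rank-one register is unchanged.

MAIN THEOREMS.
* §5 **`lone_right_budget` / `lone_left_budget`** — under the hypotheses of `lone_letter_right_allRates` (resp. `_left_`) in the pencil currency
  (`βₘ = dₘ − e`), every finite set of positive scales carrying a RIGHT (resp. LEFT) critical point of the window profile has at most TWO elements:
  three of them would carry three DISTINCT directions (`RootCount.critical_x_unique`), sorted `tₚ < T₁ < T₂ < T₃`, which the law forbids.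
  Corollaries **`rankOne_card_posRoots_le_three_add_of_lone_right`** (`Z₊ ≤ C_L + 3`) and **`rankOne_card_posRoots_le_five_of_middle`**
  (`K = 3` letters with the pivot letter's position BETWEEN the other two ⇒ `Z₊ ≤ 5` from the two lone-letter laws alone — an end-to-end
  instance of the pipeline; the number coincides with the Descartes value of `…PivotRankOneThree`, whose extremal FIVE object has both
  letters on ONE side of the pivot letter; the located value for the middle configuration is `3`, seat memo ROOT-COUNT.md — OPEN).
* §6 CENSUS CURRENCY: `det_rankOne_hyperbolic_eval` (`det F(x) = A C − (U + x^e)²` for `Fin K` letters, `J = [[0,1],[1,0]]`,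
  `P k = wₖ·(1,tₖ)(1,tₖ)ᵀ`) and **`pivotPosRoots_le_of_sideBudgets`**: `pivotPosRoots e d J P ≤ C_L + C_R + 1`;
  **`pivotPosRoots_le_three_add_of_lone_right`**.

[folklore] Sorting three reals (`Finset.orderEmbOfFin`), `2 × 2` determinants (`Matrix.det_fin_two`), `RingHom.map_det` for evaluation;
tree theorems named above.  No definitions, no named facts.
-/

-- `Summit.ValiantsHypothesis.ValiantsHypothesis.…` repeats a component by the D-0017 layout
-- (single-conjunct summit), which the `dupNamespace` linter flags; the name is mandated.
set_option linter.dupNamespace false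

namespace Summit.ValiantsHypothesis.ValiantsHypothesis.Theorems.LacunarySymmetroidMatrixDescartes.Pivot.CriticalWindows.RootCount

open Polynomial Finset Set Matrix
open scoped BigOperators
open Summit.ValiantsHypothesis.ValiantsHypothesis.Theorems.LacunarySymmetroidMatrixDescartes.Pivot (pivotPosRoots)
open Summit.ValiantsHypothesis.ValiantsHypothesis.Theorems.LacunarySymmetroidMatrixDescartes.Pivot.CriticalWindows.Lone
  (lone_letter_right_allRates lone_letter_left_allRates)

/-! ## 5. The lone side contributes at most two -/

/-- Three distinct reals can be listed in increasing order. [folklore] -/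
theorem exists_three_sorted {P : ℝ → Prop} {a b c : ℝ} (ha : P a) (hb : P b) (hc : P c) (hab : a ≠ b) (hac : a ≠ c) (hbc : b ≠ c) :
    ∃ T₁ T₂ T₃, P T₁ ∧ P T₂ ∧ P T₃ ∧ T₁ < T₂ ∧ T₂ < T₃ := by
  classical
  have hcard : ({a, b, c} : Finset ℝ).card = 3 := by
    rw [Finset.card_insert_of_notMem, Finset.card_insert_of_notMem, Finset.card_singleton]
    · simpa using hbc
    · simp [hab, hac]
  set r := ({a, b, c} : Finset ℝ).orderEmbOfFin hcard with hr
  have hmem : ∀ i, r i ∈ ({a, b, c} : Finset ℝ) := fun i => Finset.orderEmbOfFin_mem _ _ _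
  have hP : ∀ i, P (r i) := by
    intro i
    have h := hmem i
    simp only [Finset.mem_insert, Finset.mem_singleton] at h
    rcases h with h | h | h <;> rw [h] <;> assumption
  exact ⟨r 0, r 1, r 2, hP 0, hP 1, hP 2, r.strictMono (by decide), r.strictMono (by decide)⟩

/-- **LONE RIGHT LETTER ⇒ RIGHT BUDGET TWO.**  Under the hypotheses of `…LoneAllRates.lone_letter_right_allRates` in the pencil currency
(`βₘ = dₘ − e`: `dₚ < e < dₘ`; one letter `j` with `tₚ < tⱼ`, all other letters with `tₘ < tₚ`, at least one of them), every finite set of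
positive scales carrying a RIGHT critical point has at most two elements: three of them would carry three distinct directions
`tₚ < T₁ < T₂ < T₃` (`critical_x_unique`), which the lone-letter law forbids. [this file + p698043] -/
theorem lone_right_budget {ι : Type*} (s : Finset ι) (w t : ι → ℝ) (d : ι → ℕ) (e : ℕ) (p j : ι)
    (hp : p ∈ s) (hj : j ∈ s) (hpj : p ≠ j) (hleft : ∃ m ∈ s, m ≠ p ∧ m ≠ j)
    (hw : ∀ m ∈ s, 0 < w m) (ht : ∀ m ∈ s, 0 < t m) (hdp : d p < e) (hdm : ∀ m ∈ s, m ≠ p → e < d m)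
    (htp : ∀ m ∈ s, m ≠ p → m ≠ j → t m < t p) (hpj' : t p < t j)
    (S : Finset ℝ) (hS : ∀ x ∈ S, 0 < x ∧ ∃ T, t p < T ∧
        (∑ m ∈ s, w m * x ^ d m * (T ^ 2 - t m ^ 2) = 0) ∧
        (∑ m ∈ s, ((d m : ℝ) - e) * (w m * x ^ d m) * (T - t m) ^ 2 = 0)) :
    S.card ≤ 2 := by
  classical
  by_contra hcard
  push Not at hcard
  obtain ⟨x₁, x₂, x₃, hx₁, hx₂, hx₃, h12, h13, h23⟩ := Finset.two_lt_card_iff.1 hcard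
  have hde : ∀ m ∈ s, d m ≠ e := by
    intro m hm
    by_cases hmp : m = p
    · rw [hmp]; exact hdp.ne
    · exact (hdm m hm hmp).ne'
  have hnp : ∃ m ∈ s, t m ≠ t p := ⟨j, hj, hpj'.ne'⟩
  -- the directions carried by the three scales
  choose T hT using fun x (hx : x ∈ S) => (hS x hx).2
  -- the predicate «T is a right critical direction»
  set P : ℝ → Prop := fun T' => t p < T' ∧ ∃ x, 0 < x ∧
      (∑ m ∈ s, w m * x ^ d m * (T' ^ 2 - t m ^ 2) = 0) ∧
      (∑ m ∈ s, ((d m : ℝ) - e) * (w m * x ^ d m) * (T' - t m) ^ 2 = 0) with hPdef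
  have hPT : ∀ x (hx : x ∈ S), P (T x hx) := fun x hx =>
    ⟨(hT x hx).1, x, (hS x hx).1, (hT x hx).2.1, (hT x hx).2.2⟩
  have hinj : ∀ x (hx : x ∈ S) y (hy : y ∈ S), T x hx = T y hy → x = y := by
    intro x hx y hy hxy
    have h2x := (hT x hx).2.2
    have h2y := (hT y hy).2.2
    rw [hxy] at h2x
    exact critical_x_unique s w t d e p hp hw hde hnp (hS x hx).1 (hS y hy).1 h2x h2y
  have hT12 : T x₁ hx₁ ≠ T x₂ hx₂ := fun h => h12 (hinj _ _ _ _ h)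
  have hT13 : T x₁ hx₁ ≠ T x₃ hx₃ := fun h => h13 (hinj _ _ _ _ h)
  have hT23 : T x₂ hx₂ ≠ T x₃ hx₃ := fun h => h23 (hinj _ _ _ _ h)
  obtain ⟨T₁, T₂, T₃, ⟨h01, y₁, hy₁, c₁, c₁'⟩, ⟨-, y₂, hy₂, c₂, c₂'⟩, ⟨-, y₃, hy₃, c₃, c₃'⟩, hT₁₂, hT₂₃⟩ :=
    exists_three_sorted (hPT x₁ hx₁) (hPT x₂ hx₂) (hPT x₃ hx₃) hT12 hT13 hT23
  have hd : ∀ m ∈ s, (d m : ℝ) - (d p : ℝ) = 1 * (((d m : ℝ) - e) - ((d p : ℝ) - e)) := fun m _ => by ring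
  have hβp : (d p : ℝ) - e < 0 := by
    have : (d p : ℝ) < e := by exact_mod_cast hdp
    linarith
  have hβ : ∀ m ∈ s, m ≠ p → 0 < (d m : ℝ) - e := by
    intro m hm hmp
    have : (e : ℝ) < d m := by exact_mod_cast hdm m hm hmp
    linarith
  exact lone_letter_right_allRates s (fun m => (d m : ℝ) - e) t w d p j 1 hp hj hpj hleft hw hβp hβ ht htp hpj' one_pos hd
    hy₁ hy₂ hy₃ h01 hT₁₂ hT₂₃ c₁ c₁' c₂ c₂' c₃ c₃'

/-- **LONE LEFT LETTER ⇒ LEFT BUDGET TWO** (mirror: one letter `j` with `tⱼ < tₚ`, all others beyond `tₚ`). [this file + p698043] -/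
theorem lone_left_budget {ι : Type*} (s : Finset ι) (w t : ι → ℝ) (d : ι → ℕ) (e : ℕ) (p j : ι)
    (hp : p ∈ s) (hj : j ∈ s) (hpj : p ≠ j) (hright : ∃ m ∈ s, m ≠ p ∧ m ≠ j)
    (hw : ∀ m ∈ s, 0 < w m) (ht : ∀ m ∈ s, 0 < t m) (hdp : d p < e) (hdm : ∀ m ∈ s, m ≠ p → e < d m)
    (htp : ∀ m ∈ s, m ≠ p → m ≠ j → t p < t m) (hjp : t j < t p)
    (S : Finset ℝ) (hS : ∀ x ∈ S, 0 < x ∧ ∃ T, 0 < T ∧ T < t p ∧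
        (∑ m ∈ s, w m * x ^ d m * (T ^ 2 - t m ^ 2) = 0) ∧
        (∑ m ∈ s, ((d m : ℝ) - e) * (w m * x ^ d m) * (T - t m) ^ 2 = 0)) :
    S.card ≤ 2 := by
  classical
  by_contra hcard
  push Not at hcard
  obtain ⟨x₁, x₂, x₃, hx₁, hx₂, hx₃, h12, h13, h23⟩ := Finset.two_lt_card_iff.1 hcard
  have hde : ∀ m ∈ s, d m ≠ e := by
    intro m hm
    by_cases hmp : m = p
    · rw [hmp]; exact hdp.ne
    · exact (hdm m hm hmp).ne'
  have hnp : ∃ m ∈ s, t m ≠ t p := ⟨j, hj, hjp.ne⟩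
  choose T hT using fun x (hx : x ∈ S) => (hS x hx).2
  set P : ℝ → Prop := fun T' => (0 < T' ∧ T' < t p) ∧ ∃ x, 0 < x ∧
      (∑ m ∈ s, w m * x ^ d m * (T' ^ 2 - t m ^ 2) = 0) ∧
      (∑ m ∈ s, ((d m : ℝ) - e) * (w m * x ^ d m) * (T' - t m) ^ 2 = 0) with hPdef
  have hPT : ∀ x (hx : x ∈ S), P (T x hx) := fun x hx =>
    ⟨⟨(hT x hx).1, (hT x hx).2.1⟩, x, (hS x hx).1, (hT x hx).2.2.1, (hT x hx).2.2.2⟩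
  have hinj : ∀ x (hx : x ∈ S) y (hy : y ∈ S), T x hx = T y hy → x = y := by
    intro x hx y hy hxy
    have h2x := (hT x hx).2.2.2
    have h2y := (hT y hy).2.2.2
    rw [hxy] at h2x
    exact critical_x_unique s w t d e p hp hw hde hnp (hS x hx).1 (hS y hy).1 h2x h2y
  have hT12 : T x₁ hx₁ ≠ T x₂ hx₂ := fun h => h12 (hinj _ _ _ _ h)
  have hT13 : T x₁ hx₁ ≠ T x₃ hx₃ := fun h => h13 (hinj _ _ _ _ h)
  have hT23 : T x₂ hx₂ ≠ T x₃ hx₃ := fun h => h23 (hinj _ _ _ _ h)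
  obtain ⟨T₁, T₂, T₃, ⟨⟨hT₁, -⟩, y₁, hy₁, c₁, c₁'⟩, ⟨-, y₂, hy₂, c₂, c₂'⟩, ⟨⟨-, h3p⟩, y₃, hy₃, c₃, c₃'⟩, hT₁₂, hT₂₃⟩ :=
    exists_three_sorted (hPT x₁ hx₁) (hPT x₂ hx₂) (hPT x₃ hx₃) hT12 hT13 hT23
  have hd : ∀ m ∈ s, (d m : ℝ) - (d p : ℝ) = 1 * (((d m : ℝ) - e) - ((d p : ℝ) - e)) := fun m _ => by ring
  have hβp : (d p : ℝ) - e < 0 := by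
    have : (d p : ℝ) < e := by exact_mod_cast hdp
    linarith
  have hβ : ∀ m ∈ s, m ≠ p → 0 < (d m : ℝ) - e := by
    intro m hm hmp
    have : (e : ℝ) < d m := by exact_mod_cast hdm m hm hmp
    linarith
  exact lone_letter_left_allRates s (fun m => (d m : ℝ) - e) t w d p j 1 hp hj hpj hright hw hβp hβ ht htp hjp one_pos hd
    hy₁ hy₂ hy₃ hT₁ hT₁₂ hT₂₃ h3p c₁ c₁' c₂ c₂' c₃ c₃'

/-- **COROLLARY: A LONE LETTER BEYOND THE PIVOT COSTS AT MOST THREE ROOTS BEYOND THE LEFT BUDGET** — `Z₊(f) ≤ C_L + 3` whenever exactly one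
letter lies beyond the pivot letter's position and the left critical points obey a budget `C_L`. [this file] -/
theorem rankOne_card_posRoots_le_three_add_of_lone_right {ι : Type*} (s : Finset ι) (w t : ι → ℝ) (d : ι → ℕ) (e : ℕ) (p j : ι)
    (hp : p ∈ s) (hj : j ∈ s) (hpj : p ≠ j) (hleft : ∃ m ∈ s, m ≠ p ∧ m ≠ j)
    (hw : ∀ m ∈ s, 0 < w m) (ht : ∀ m ∈ s, 0 < t m) (hdp : d p < e) (hdm : ∀ m ∈ s, m ≠ p → e < d m)
    (htp : ∀ m ∈ s, m ≠ p → m ≠ j → t m < t p) (hpj' : t p < t j) (f : ℝ[X])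
    (hf : ∀ x, 0 < x → (f.IsRoot x ↔ (∑ k ∈ s, w k * x ^ d k) * (∑ k ∈ s, w k * t k ^ 2 * x ^ d k)
      - ((∑ k ∈ s, w k * t k * x ^ d k) + x ^ e) ^ 2 = 0))
    (CL : ℕ)
    (hL : ∀ S : Finset ℝ, (∀ x ∈ S, 0 < x ∧ ∃ T, 0 < T ∧ T < t p ∧
        (∑ m ∈ s, w m * x ^ d m * (T ^ 2 - t m ^ 2) = 0) ∧
        (∑ m ∈ s, ((d m : ℝ) - e) * (w m * x ^ d m) * (T - t m) ^ 2 = 0)) → S.card ≤ CL) :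
    (f.roots.toFinset.filter (fun t => 0 < t)).card ≤ CL + 3 :=
  rankOne_card_posRoots_le_of_sideBudgets s w t d e p hp hw ht hdp hdm ⟨j, hj, hpj'.ne'⟩ f hf CL 2 hL
    (lone_right_budget s w t d e p j hp hj hpj hleft hw ht hdp hdm htp hpj')


/-- **COROLLARY: MIDDLE PIVOT AT `K = 3` ⇒ `Z₊ ≤ 5` BY THE TWO LONE-LETTER LAWS ALONE.**  Three letters `p, i, j` (any further letter would
violate one of the two «all others on the far side» hypotheses), the pivot letter's position between the other two (`tᵢ < tₚ < tⱼ`),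
`dₚ < e < dᵢ, dⱼ`: both sides have budget two, so `Z₊(f) ≤ 5`.  An end-to-end instance of the pipeline (the value `5` is also the Descartes
value of `…PivotRankOneThree`; the located truth here is `3` — OPEN). [this file] -/
theorem rankOne_card_posRoots_le_five_of_middle {ι : Type*} (s : Finset ι) (w t : ι → ℝ) (d : ι → ℕ) (e : ℕ) (p i j : ι)
    (hp : p ∈ s) (hi : i ∈ s) (hj : j ∈ s) (hpi : p ≠ i) (hpj : p ≠ j) (hij : i ≠ j)
    (hw : ∀ m ∈ s, 0 < w m) (ht : ∀ m ∈ s, 0 < t m) (hdp : d p < e) (hdm : ∀ m ∈ s, m ≠ p → e < d m)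
    (hleft : ∀ m ∈ s, m ≠ p → m ≠ j → t m < t p) (hright : ∀ m ∈ s, m ≠ p → m ≠ i → t p < t m)
    (hip : t i < t p) (hpj' : t p < t j) (f : ℝ[X])
    (hf : ∀ x, 0 < x → (f.IsRoot x ↔ (∑ k ∈ s, w k * x ^ d k) * (∑ k ∈ s, w k * t k ^ 2 * x ^ d k)
      - ((∑ k ∈ s, w k * t k * x ^ d k) + x ^ e) ^ 2 = 0)) :
    (f.roots.toFinset.filter (fun t => 0 < t)).card ≤ 5 :=
  rankOne_card_posRoots_le_of_sideBudgets s w t d e p hp hw ht hdp hdm ⟨j, hj, hpj'.ne'⟩ f hf 2 2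
    (lone_left_budget s w t d e p i hp hi hpi ⟨j, hj, hpj.symm, hij.symm⟩ hw ht hdp hdm hright hip)
    (lone_right_budget s w t d e p j hp hj hpj ⟨i, hi, hpi.symm, hij⟩ hw ht hdp hdm hleft hpj')

/-! ## 6. Census currency: `pivotPosRoots` for the hyperbolic normal form -/

/-- **`det F(x) = A C − (U + x^e)²`** for the hyperbolic normal form `F = X^e [[0,1],[1,0]] + ∑ₖ X^{dₖ}·(wₖ (1,tₖ)(1,tₖ)ᵀ)` with `Fin K` letters:
the evaluation of the determinant of the polynomial matrix at a real `x`. [folklore] -/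
theorem det_rankOne_hyperbolic_eval (K e : ℕ) (d : Fin K → ℕ) (w t : Fin K → ℝ) (x : ℝ) :
    (Matrix.det (((X : ℝ[X]) ^ e) • (!![(0 : ℝ), 1; 1, 0] : Matrix (Fin 2) (Fin 2) ℝ).map Polynomial.C
        + ∑ k, ((X : ℝ[X]) ^ d k) • (w k • vecMulVec ![1, t k] ![1, t k]).map Polynomial.C)).eval x
      = (∑ k, w k * x ^ d k) * (∑ k, w k * t k ^ 2 * x ^ d k) - ((∑ k, w k * t k * x ^ d k) + x ^ e) ^ 2 := by
  rw [← Polynomial.coe_evalRingHom, RingHom.map_det, Matrix.det_fin_two]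
  simp only [RingHom.mapMatrix_apply, Matrix.map_apply, Matrix.add_apply, Matrix.smul_apply, Matrix.sum_apply, vecMulVec_apply,
    Matrix.of_apply, Matrix.cons_val', Matrix.cons_val_zero, Matrix.cons_val_one, Matrix.empty_val', Matrix.cons_val_fin_one,
    smul_eq_mul, Polynomial.coe_evalRingHom, Polynomial.eval_mul, Polynomial.eval_pow, Polynomial.eval_X, Polynomial.eval_C, map_add,
    map_sum, map_mul]
  ring

/-- **THE PIPELINE IN CENSUS CURRENCY.**  For the hyperbolic normal form with `Fin K` rank-one letters (`J = [[0,1],[1,0]]`,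
`P k = wₖ·(1,tₖ)(1,tₖ)ᵀ`, positive `wₖ, tₖ`, one letter `p` with `dₚ < e`, the others with `e < dₖ`, not all parallel): side budgets `C_L`, `C_R`
for the critical points of the window profile give **`pivotPosRoots e d J P ≤ C_L + C_R + 1`**. [this file] -/
theorem pivotPosRoots_le_of_sideBudgets (K e : ℕ) (d : Fin K → ℕ) (w t : Fin K → ℝ) (p : Fin K)
    (hw : ∀ m, 0 < w m) (ht : ∀ m, 0 < t m) (hdp : d p < e) (hdm : ∀ m, m ≠ p → e < d m) (hnp : ∃ m, t m ≠ t p) (CL CR : ℕ)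
    (hL : ∀ S : Finset ℝ, (∀ x ∈ S, 0 < x ∧ ∃ T, 0 < T ∧ T < t p ∧
        (∑ m, w m * x ^ d m * (T ^ 2 - t m ^ 2) = 0) ∧
        (∑ m, ((d m : ℝ) - e) * (w m * x ^ d m) * (T - t m) ^ 2 = 0)) → S.card ≤ CL)
    (hR : ∀ S : Finset ℝ, (∀ x ∈ S, 0 < x ∧ ∃ T, t p < T ∧
        (∑ m, w m * x ^ d m * (T ^ 2 - t m ^ 2) = 0) ∧
        (∑ m, ((d m : ℝ) - e) * (w m * x ^ d m) * (T - t m) ^ 2 = 0)) → S.card ≤ CR) :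
    pivotPosRoots e d (!![(0 : ℝ), 1; 1, 0]) (fun k => w k • vecMulVec ![1, t k] ![1, t k]) ≤ CL + CR + 1 := by
  unfold pivotPosRoots
  refine rankOne_card_posRoots_le_of_sideBudgets (Finset.univ : Finset (Fin K)) w t d e p (Finset.mem_univ p)
    (fun m _ => hw m) (fun m _ => ht m) hdp (fun m _ hm => hdm m hm) ?_ _ ?_ CL CR ?_ ?_
  · obtain ⟨m, hm⟩ := hnp
    exact ⟨m, Finset.mem_univ m, hm⟩
  · intro x hx
    rw [Polynomial.IsRoot.def, det_rankOne_hyperbolic_eval]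
  · intro S hS
    exact hL S fun x hx => hS x hx
  · intro S hS
    exact hR S fun x hx => hS x hx

/-- **LONE RIGHT LETTER IN CENSUS CURRENCY: `pivotPosRoots ≤ C_L + 3`.** [this file] -/
theorem pivotPosRoots_le_three_add_of_lone_right (K e : ℕ) (d : Fin K → ℕ) (w t : Fin K → ℝ) (p j : Fin K) (hpj : p ≠ j)
    (hleft : ∃ m, m ≠ p ∧ m ≠ j) (hw : ∀ m, 0 < w m) (ht : ∀ m, 0 < t m) (hdp : d p < e) (hdm : ∀ m, m ≠ p → e < d m)
    (htp : ∀ m, m ≠ p → m ≠ j → t m < t p) (hpj' : t p < t j) (CL : ℕ)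
    (hL : ∀ S : Finset ℝ, (∀ x ∈ S, 0 < x ∧ ∃ T, 0 < T ∧ T < t p ∧
        (∑ m, w m * x ^ d m * (T ^ 2 - t m ^ 2) = 0) ∧
        (∑ m, ((d m : ℝ) - e) * (w m * x ^ d m) * (T - t m) ^ 2 = 0)) → S.card ≤ CL) :
    pivotPosRoots e d (!![(0 : ℝ), 1; 1, 0]) (fun k => w k • vecMulVec ![1, t k] ![1, t k]) ≤ CL + 3 := by
  refine pivotPosRoots_le_of_sideBudgets K e d w t p hw ht hdp hdm ⟨j, hpj'.ne'⟩ CL 2 hL ?_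
  obtain ⟨m, hmp, hmj⟩ := hleft
  exact lone_right_budget Finset.univ w t d e p j (Finset.mem_univ p) (Finset.mem_univ j) hpj ⟨m, Finset.mem_univ m, hmp, hmj⟩
    (fun m _ => hw m) (fun m _ => ht m) hdp (fun m _ hm => hdm m hm) (fun m _ h1 h2 => htp m h1 h2) hpj'

end Summit.ValiantsHypothesis.ValiantsHypothesis.Theorems.LacunarySymmetroidMatrixDescartes.Pivot.CriticalWindows.RootCount
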